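import Summits.ResolutionOfSingularities.ResolutionOfSingularities.Theorems.FrobeniusClosingSteerToricUnitExitPhi
import Summits.ResolutionOfSingularities.ResolutionOfSingularities.Theorems.FrobeniusClosingSteerToricUnitExitStepChart
import Summits.ResolutionOfSingularities.ResolutionOfSingularities.Theorems.FrobeniusClosingSteerGenericPerron

/-!
# Crux `Steer` (stmt-ResolutionOfSingularities-16345) — K-TX part 4d, the GENUINE step of the transported frame (chart descent of `Φ`,
# tie-births with a fresh variable and dual weight), the step dichotomy, and the transported Perron / monomialisation / odd-support
# reduction (instances of `…SteerGenericPerron`)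

OURS (design: seat folder `D/res-D-brk-2/HANDOFF.md`, gen 6, "4d route REFINED"); [cite: NovacoskiSpivakovsky2014, Def. 2.11];
[cite: DeJong1996, 2.4].

* `prel_step_div` — pivot `z_a` a NON-unit, `v(z_b) ≤ v(z_a)`: the frame moves along the chart of `…StepChart.frame_step_div_chart`; `Φ`
  descends through the chart (`ResCompat.exists_extend_chart`, prescribed value `0` on the new letter `u = z_b/z_a` if it is a non-unit,
  a FRESH variable `Y_(u,B)` if it is a unit — a tie-birth, `DualRows.birth`) and extends to the localisation
  (`ResCompat.exists_extend_locAtCentre`);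
* `prel_step` — the dichotomy the generic exponent game wants;
* `exists_prel_uniform`, `exists_prel_nonneg_family`, `exists_prel_single_odd` — the generic theorems instantiated with `PRel`.
-/

noncomputable section

-- single-problem summit: the doubled namespace component `ResolutionOfSingularities` is forced
set_option linter.dupNamespace false

open scoped BigOperators

namespace Summit.ResolutionOfSingularities.ResolutionOfSingularities.Theorems.SteerToricUnitExit

open IsLocalRing MvPolynomial
open Literature.AlgebraicGeometry.Resolution
open Summit.ResolutionOfSingularities.ResolutionOfSingularities.Theorems.SwitchingDichotomy
open Summit.ResolutionOfSingularities.ResolutionOfSingularities.Theorems.SteerToricVertexSplit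

variable {K : Type} [Field K]

section DivStep

variable {O : ValuationSubring K} [(kerRes O).IsPrime] {n : ℕ} {R₀ : Subring K}

/-- **The genuine step of the transported frame.** See the module docstring. OURS. [cite: NovacoskiSpivakovsky2014, Def. 2.11] -/
theorem prel_step_div (s : TState O n) (hs : Good R₀ s) {a b : Fin n} (hab : a ≠ b) (hva : O.valuation (s.z a) < 1)
    (hle : O.valuation (s.z b) ≤ O.valuation (s.z a)) :
    ∃ s' : TState O n, PRel R₀ s s' (fun f => Function.update f a (f a + f b)) := by
  classical
  obtain ⟨hF, hRO, hR₀, hΦ, hconst, hkill, hunit, hsupp, hcB, hdual⟩ := hs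
  have hz0 := hF.ne_zero
  have hzR : ∀ j, s.z j ∈ s.R := by obtain ⟨_, _, _, _, _, hz, _⟩ := hF; exact hz
  have hvb : O.valuation (s.z b) < 1 := lt_of_le_of_lt hle hva
  obtain ⟨c, hc0, hc1, hqr, hci, hmax, hbl, hF'⟩ := frame_step_div_chart O s.R s.z hF hab hva hle
  set C : Subring K := Subring.closure ((s.R : Set K) ∪ Set.range fun j => ((c j : s.R) : K) / ((c 0 : s.R) : K)) with hCdef
  have hCO : C ≤ O.toSubring := ChartRsop.closure_chart_le hRO c 0 hci hmax
  have hR'O : locAtCentre C O ≤ O.toSubring := locAtCentre_le hCO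
  have hRC : s.R ≤ C := ChartRsop.le_closure_chart s.R c 0
  have hCR' : C ≤ locAtCentre C O := le_locAtCentre C O
  set u : K := s.z b / s.z a with hudef
  have hu_eq : ((c 1 : s.R) : K) / ((c 0 : s.R) : K) = u := by rw [hc0, hc1]
  have huC : u ∈ C := hu_eq ▸ ChartRsop.div_mem_closure_chart s.R c 0 1
  have huO : u ∈ O := hCO huC
  -- `Φ` kills the quasi-regular pair
  have hx : ∀ j : Fin 2, s.Φ (c j) = 0 := by
    intro j; fin_cases j
    · exact hkill a (c 0) hc0 hva
    · exact hkill b (c 1) hc1 hvb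
  have hj1 : ∀ j : {j : Fin 2 // j ≠ 0}, j.1 = 1 := fun j => by
    rcases j with ⟨j, hj⟩; fin_cases j
    · exact absurd rfl hj
    · rfl
  -- letters other than `b` do not move
  have hzj : ∀ j, j ≠ b → Function.update s.z b u j = s.z j := fun j hj => Function.update_of_ne hj _ _
  have hkrel : KRel O s.R s.z (locAtCentre C O) (Function.update s.z b u) (fun f => Function.update f a (f a + f b)) :=
    ⟨hbl, hF', prod_zpow_update_shift s.z hz0 hab, shift_neg a b, fun f hf => shift_nonneg a b hf, fun f hf => shift_odd hab hf⟩
  -- the prescribed value on the new letter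
  by_cases hvu : O.valuation u < 1
  · -- `u` a non-unit: value `0`
    have hτ : ∀ j : {j : Fin 2 // j ≠ 0}, evalResL O (0 : Localization.AtPrime (kerRes O)) =
        residue O ⟨((c j.1 : s.R) : K) / ((c 0 : s.R) : K), hCO (ChartRsop.div_mem_closure_chart s.R c 0 j.1)⟩ := by
      intro j
      rw [map_zero, eq_comm, residue_eq_zero_iff, ValuationSubring.valuation_lt_one_iff]
      change O.valuation (((c j.1 : s.R) : K) / ((c 0 : s.R) : K)) < 1
      rw [hj1 j, hu_eq]; exact hvu
    obtain ⟨ΦC, hΦC, hΦCS, hΦCX⟩ := hΦ.exists_extend_chart hRO c hqr 0 hci hCO s.Φ hx (fun _ => 0) hτ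
    obtain ⟨Φ', hΦ', hΦ'C⟩ := hΦC.exists_extend_locAtCentre hCO ΦC
    have hext : ∀ (r : s.R) (r' : locAtCentre C O), (r : K) = r' → Φ' r' = s.Φ r := by
      intro r r' h
      rw [show r' = ⟨(r : K), hCR' (hRC r.2)⟩ from Subtype.ext h.symm]
      exact (hΦ'C ⟨r, hRC r.2⟩).trans (hΦCS r)
    have hΦ'u : ∀ r' : locAtCentre C O, (r' : K) = u → Φ' r' = 0 := by
      intro r' hr'
      have e : r' = ⟨((c 1 : s.R) : K) / ((c 0 : s.R) : K), hCR' (ChartRsop.div_mem_closure_chart s.R c 0 1)⟩ :=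
        Subtype.ext (hr'.trans hu_eq.symm)
      rw [e, hΦ'C ⟨_, ChartRsop.div_mem_closure_chart s.R c 0 1⟩]
      exact hΦCX ⟨1, one_ne_zero⟩
    have hU : {j : Fin n | O.valuation (Function.update s.z b u j) = 1} = {j | O.valuation (s.z j) = 1} := by
      ext j; by_cases hjb : j = b
      · subst hjb
        simp only [Set.mem_setOf_eq, Function.update_self]
        constructor
        · intro h; rw [h] at hvu; exact absurd hvu (lt_irrefl _)
        · intro h; rw [h] at hvb; exact absurd hvb (lt_irrefl _)
      · simp [hzj j hjb]
    have hgood' : GoodPhi R₀ (⟨locAtCentre C O, Function.update s.z b u, Φ', s.kp, s.km, s.γ, s.c, s.B⟩ : TState O n) := by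
      refine ⟨hR'O, hR₀.trans (hRC.trans hCR'), hΦ', fun r' hr' => ?_, fun j r' hr hvj => ?_, fun j r' hr hvj => ?_, hsupp, hcB,
        ?_⟩ <;> dsimp only at *
      · rw [hext ⟨(r' : K), hR₀ hr'⟩ r' rfl]; exact hconst ⟨(r' : K), hR₀ hr'⟩ hr'
      · by_cases hjb : j = b
        · subst hjb; rw [Function.update_self] at hr; exact hΦ'u r' hr
        · rw [hzj j hjb] at hr hvj
          rw [hext ⟨s.z j, hzR j⟩ r' hr.symm]; exact hkill j ⟨s.z j, hzR j⟩ rfl hvj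
      · have hjb : j ≠ b := by rintro rfl; rw [Function.update_self] at hvj; rw [hvj] at hvu; exact lt_irrefl _ hvu
        rw [hzj j hjb] at hr hvj
        rw [hext ⟨s.z j, hzR j⟩ r' hr.symm]; exact hunit j ⟨s.z j, hzR j⟩ rfl hvj
      · rw [hU]; exact hdual
    exact ⟨⟨locAtCentre C O, Function.update s.z b u, Φ', s.kp, s.km, s.γ, s.c, s.B⟩, hkrel, hRC.trans hCR', hgood', hext⟩
  · -- `u` a unit: a tie-birth with the fresh variable `(u, B)`
    have hvu1 : O.valuation u = 1 := le_antisymm ((O.valuation_le_one_iff _).mpr huO) (not_lt.mp hvu)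
    set v : K × ℕ := (u, s.B) with hvdef
    have hτ : ∀ j : {j : Fin 2 // j ≠ 0},
        evalResL O (algebraMap (MvPolynomial (K × ℕ) (ResidueField O)) (Localization.AtPrime (kerRes O)) (X v)) =
        residue O ⟨((c j.1 : s.R) : K) / ((c 0 : s.R) : K), hCO (ChartRsop.div_mem_closure_chart s.R c 0 j.1)⟩ := by
      intro j
      rw [evalResL_algebraMap, evalRes_X, resK_of_mem O huO]
      congr 1; apply Subtype.ext
      change u = ((c j.1 : s.R) : K) / ((c 0 : s.R) : K)
      rw [hj1 j, hu_eq]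
    obtain ⟨ΦC, hΦC, hΦCS, hΦCX⟩ := hΦ.exists_extend_chart hRO c hqr 0 hci hCO s.Φ hx (fun _ => algebraMap _ _ (X v)) hτ
    obtain ⟨Φ', hΦ', hΦ'C⟩ := hΦC.exists_extend_locAtCentre hCO ΦC
    have hext : ∀ (r : s.R) (r' : locAtCentre C O), (r : K) = r' → Φ' r' = s.Φ r := by
      intro r r' h
      rw [show r' = ⟨(r : K), hCR' (hRC r.2)⟩ from Subtype.ext h.symm]
      exact (hΦ'C ⟨r, hRC r.2⟩).trans (hΦCS r)
    have hΦ'u : ∀ r' : locAtCentre C O, (r' : K) = u →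
        Φ' r' = algebraMap (MvPolynomial (K × ℕ) (ResidueField O)) (Localization.AtPrime (kerRes O)) (X v) := by
      intro r' hr'
      have e : r' = ⟨((c 1 : s.R) : K) / ((c 0 : s.R) : K), hCR' (ChartRsop.div_mem_closure_chart s.R c 0 1)⟩ :=
        Subtype.ext (hr'.trans hu_eq.symm)
      rw [e, hΦ'C ⟨_, ChartRsop.div_mem_closure_chart s.R c 0 1⟩]
      exact hΦCX ⟨1, one_ne_zero⟩
    have hbU : b ∉ {j : Fin n | O.valuation (s.z j) = 1} := by
      simp only [Set.mem_setOf_eq]; intro h; rw [h] at hvb; exact lt_irrefl _ hvb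
    have hU : {j : Fin n | O.valuation (Function.update s.z b u j) = 1} = insert b {j | O.valuation (s.z j) = 1} := by
      ext j; by_cases hjb : j = b
      · subst hjb; simp [hvu1]
      · simp [hjb]
    -- no current row or weight involves the fresh variable
    have hkv : ∀ j ∈ {j : Fin n | O.valuation (s.z j) = 1}, rowZ (s.kp j) (s.km j) v = 0 := by
      intro j _
      have hnot : v ∉ (s.kp j + s.km j).support := fun h => by have := (hsupp j v h).2; simp [hvdef] at this
      rw [Finsupp.mem_support_iff, not_not, Finsupp.add_apply, Nat.add_eq_zero_iff] at hnot
      exact rowZ_apply_eq_zero _ _ v hnot.1 hnot.2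
    have hcv : ∀ j ∈ {j : Fin n | O.valuation (s.z j) = 1}, s.c j v = 0 := fun j _ => hcB j v (by simp [hvdef])
    have hgood' : GoodPhi R₀ (⟨locAtCentre C O, Function.update s.z b u, Φ', Function.update s.kp b (Finsupp.single v 1),
        Function.update s.km b 0, Function.update s.γ b 1, Function.update s.c b (Pi.single v 1), s.B + 1⟩ : TState O n) := by
      refine ⟨hR'O, hR₀.trans (hRC.trans hCR'), hΦ', fun r' hr' => ?_, fun j r' hr hvj => ?_, fun j r' hr hvj => ?_,
        fun j v' hv' => ?_, fun j v' hv' => ?_, ?_⟩ <;> dsimp only at *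
      · rw [hext ⟨(r' : K), hR₀ hr'⟩ r' rfl]; exact hconst ⟨(r' : K), hR₀ hr'⟩ hr'
      · have hjb : j ≠ b := by rintro rfl; rw [Function.update_self, hvu1] at hvj; exact lt_irrefl _ hvj
        rw [hzj j hjb] at hr hvj
        rw [hext ⟨s.z j, hzR j⟩ r' hr.symm]; exact hkill j ⟨s.z j, hzR j⟩ rfl hvj
      · by_cases hjb : j = b
        · subst hjb
          rw [Function.update_self] at hr
          rw [Function.update_self, Function.update_self, Function.update_self, hΦ'u r' hr]
          refine ⟨one_ne_zero, ?_⟩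
          rw [monomial_zero', C_1, map_one, one_mul, one_mul]; rfl
        · rw [Function.update_of_ne hjb, Function.update_of_ne hjb, Function.update_of_ne hjb]
          rw [hzj j hjb] at hr hvj
          rw [hext ⟨s.z j, hzR j⟩ r' hr.symm]; exact hunit j ⟨s.z j, hzR j⟩ rfl hvj
      · by_cases hjb : j = b
        · subst hjb
          rw [Function.update_self, Function.update_self, add_zero, Finsupp.mem_support_iff, Finsupp.single_apply] at hv'
          have hvv : v = v' := by by_contra h; exact hv' (if_neg h)
          subst hvv
          exact ⟨hvu1, Nat.lt_succ_self _⟩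
        · rw [Function.update_of_ne hjb, Function.update_of_ne hjb] at hv'
          obtain ⟨h1, h2⟩ := hsupp j v' hv'
          exact ⟨h1, Nat.lt_succ_of_lt h2⟩
      · by_cases hjb : j = b
        · subst hjb
          rw [Function.update_self]
          have hne : v' ≠ v := by rintro rfl; simp [hvdef] at hv'
          exact Pi.single_eq_of_ne hne _
        · rw [Function.update_of_ne hjb]; exact hcB j v' (by omega)
      · rw [hU]
        have hrows : (fun j => rowZ (Function.update s.kp b (Finsupp.single v 1) j) (Function.update s.km b 0 j)) =
            Function.update (fun j => rowZ (s.kp j) (s.km j)) b (Finsupp.single v 1) := by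
          funext j
          by_cases hjb : j = b
          · subst hjb; simp only [Function.update_self, rowZ_single]
          · simp only [Function.update_of_ne hjb]
        rw [hrows]
        exact hdual.birth hbU v hkv hcv
    exact ⟨⟨locAtCentre C O, Function.update s.z b u, Φ', Function.update s.kp b (Finsupp.single v 1), Function.update s.km b 0,
      Function.update s.γ b 1, Function.update s.c b (Pi.single v 1), s.B + 1⟩, hkrel, hRC.trans hCR', hgood', hext⟩

/-- **The step dichotomy** of the transported frame: the valuation decides the orientation, the pivot's unit-ness the kind of step.
OURS. [cite: DeJong1996, 2.4] -/
theorem prel_step (s : TState O n) (hs : Good R₀ s) {a b : Fin n} (hab : a ≠ b) :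
    (∃ s', PRel R₀ s s' (fun f => Function.update f a (f a + f b))) ∨
      (∃ s', PRel R₀ s s' (fun f => Function.update f b (f b + f a))) := by
  have hle1 : ∀ j, O.valuation (s.z j) ≤ 1 := fun j => (O.valuation_le_one_iff _).mpr (hs.mem_O j)
  rcases le_total (O.valuation (s.z b)) (O.valuation (s.z a)) with hle | hle
  · left
    by_cases hva : O.valuation (s.z a) < 1
    · exact prel_step_div s hs hab hva hle
    · exact prel_step_unit s hs hab (le_antisymm (hle1 a) (not_lt.mp hva))
  · right
    by_cases hvb : O.valuation (s.z b) < 1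
    · exact prel_step_div s hs hab.symm hvb hle
    · exact prel_step_unit s hs hab.symm (le_antisymm (hle1 b) (not_lt.mp hvb))

end DivStep

/-! ## The transported exponent game -/

section Game

variable {O : ValuationSubring K} [(kerRes O).IsPrime] {n : ℕ} (R₀ : Subring K)

/-- **Transported Perron uniformisation.** OURS. [folklore] -/
theorem exists_prel_uniform (s : TState O n) (hs : Good R₀ s) (e : Fin n → ℤ) :
    ∃ (s' : TState O n) (T : (Fin n → ℤ) → (Fin n → ℤ)), PRel R₀ s s' T ∧ SteerGenericPerron.Uniform (T e) :=
  SteerGenericPerron.generic_uniform (P := PRel R₀) (good := Good R₀) (fun s hs => prel_refl s hs)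
    (fun h h' => prel_trans h h') (fun h => prel_good h) (fun s hs _ _ hab => prel_step s hs hab) (fun h => prel_neg h) s hs e

/-- **Transported monomialisation of finitely many Laurent monomials of positive value.** OURS. [folklore] -/
theorem exists_prel_nonneg_family (m : ℕ) (s : TState O n) (hs : Good R₀ s) (F : Fin m → Fin n → ℤ)
    (hF : ∀ i, O.valuation (∏ j, s.z j ^ F i j) < 1) :
    ∃ (s' : TState O n) (T : (Fin n → ℤ) → (Fin n → ℤ)), PRel R₀ s s' T ∧ ∀ i j, 0 ≤ T (F i) j :=
  SteerGenericPerron.generic_nonneg_family (P := PRel R₀) (good := Good R₀) (fun s hs => prel_refl s hs)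
    (fun h h' => prel_trans h h') (fun h => prel_good h) (fun s hs _ _ hab => prel_step s hs hab) (fun h => prel_neg h)
    O (fun s => s.z) (fun h => prel_mono h) (fun _ hs => hs.mem_O) (fun _ hs => hs.ne_zero) (fun h => prel_nonneg h) m s hs F hF

/-- **Transported odd-support reduction.** OURS. [folklore] -/
theorem exists_prel_single_odd (s : TState O n) (hs : Good R₀ s) (p : Fin n → ℤ) (hodd : ∃ j, Odd (p j)) :
    ∃ (s' : TState O n) (T : (Fin n → ℤ) → (Fin n → ℤ)), PRel R₀ s s' T ∧
      ∃ a, Odd (T p a) ∧ ∀ j, j ≠ a → Even (T p j) :=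
  SteerGenericPerron.generic_single_odd (P := PRel R₀) (good := Good R₀) (fun s hs => prel_refl s hs)
    (fun h h' => prel_trans h h') (fun h => prel_good h) (fun s hs _ _ hab => prel_step s hs hab) _ s hs p le_rfl hodd

end Game

end Summit.ResolutionOfSingularities.ResolutionOfSingularities.Theorems.SteerToricUnitExit

end
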